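import Mathlib
import Summits.CriticalPhenomena.PercolationContinuityZ3.Theorems.PercNearOneGluingNoHeavyLowerTailOrderedDifferences
import Summits.CriticalPhenomena.PercolationContinuityZ3.Theorems.PercNearOneGluingNoHeavyLowerTailOrientedAntipodalHall

/-!
# Conjecture W2 ('words of length two') holds for families without 2-paths and for a single 2-path / opposite pair

Helper file for crux `stmt-CriticalPhenomena-4575` (`NoHeavyLowerTail`, route `PercNearOneGluingNoHeavy`),
new-inequality factory seat `prim-ineq-gen-3` (gen 17).  Everything here is PROVED; no definitions.

CONJECTURE W2 (memo `run/shared/lean/prim/prim-ineq-gen-3/CONJECTURE-W2.md`): for a monotone labelling `f` and a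
co-intersecting family `D` of antipodal bads, the co-goods among the WORDS OF LENGTH TWO in the members — the differences
`(S \ X) \ (S \ Y)` and the meets `(S \ X) ∩ (S \ Y)`, `X, Y ∈ D` — are at least `#D` many (equivalently, by Hall over
sub-families, every bad `X` is completed to a good `X ∪ Z` by ONE other bad or ONE member, injectively).  It implies
Conjecture O_k and prim-hp-7's CoI-Kleitman, survives every instance either programme has produced (exhaustive on ≤ 5 points,
the open five-petal tournaments, the co-intersecting families without any antipodal ordered certificate), and is open from
three types on.  This file records the PROVEN range:

* `card_le_card_wordsTwo_of_noTwoPath`: if no two bads of `D` form a 2-path (the complement petal of one is never the set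
  petal of another) then already the member DIFFERENCES that are co-goods number at least `#D` (Marica–Schönheim,
  `Finset.card_le_card_diffs`); this covers one type, stars, and every 2-path-free type set on any number of petals.
* `card_add_card_le_card_wordsTwo_of_twoPath`: two classes of types `(a,b)` and `(b,d)` (a 2-path through `b`; `d = a`, an
  OPPOSITE pair, is allowed) whose members pairwise intersect: differences within the classes and the cross MEETS suffice —
  this is `MS2′` (`OrderedDifferences.card_add_card_le_card_diffs_union`) with `𝒞` the members of the first class and `ℬ` the
  bads of the second, whose block `𝒞 \\ ℬ` consists exactly of the cross meets.
(prim-ineq-gen-3 gen 17, 2026-08-22.)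
-/

namespace Summit.CriticalPhenomena.PercolationContinuityZ3.Theorems

namespace OrientedAntipodalHall

open Finset AntipodalStrongHarris AntipodalStrongHarris.Lab OrderedDifferences
open scoped FinsetFamily

variable {α : Type*} [DecidableEq α] {k : ℕ}

/-- **W2 for 2-path-free families (differences only).**  If `f` is monotone, every `X ∈ D` is a bad of type `(i X, j X)`
inside `S`, and no complement petal `j X` equals a set petal `i Y` (`X, Y ∈ D`; for `X = Y` this says `i X ≠ j X`), then the
co-good member differences `(S \ X) \ (S \ Y)` are at least `#D` many. -/
theorem card_le_card_wordsTwo_of_noTwoPath (S : Finset α) {f : Finset α → Lab k}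
    (hf : ∀ ⦃X Y : Finset α⦄, X ⊆ Y → f X ≤ f Y) (D : Finset (Finset α)) (i j : Finset α → Fin k)
    (hDS : ∀ X ∈ D, X ⊆ S) (hDi : ∀ X ∈ D, f X = petal (i X)) (hDj : ∀ X ∈ D, f (S \ X) = petal (j X))
    (hsep : ∀ X ∈ D, ∀ Y ∈ D, j X ≠ i Y) :
    #D ≤ #{G ∈ S.powerset | f G = bot ∧ f (S \ G) = top ∧
      ∃ X ∈ D, ∃ Y ∈ D, G = (S \ X) \ (S \ Y) ∨ G = (S \ X) ∩ (S \ Y)} := by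
  classical
  set M : Finset (Finset α) := D.image fun X => S \ X with hM
  have hcM : #M = #D := by
    rw [hM]
    refine card_image_of_injOn ?_
    intro X hX X' hX' h
    have e₁ := Finset.sdiff_sdiff_eq_self (hDS X hX)
    have e₂ := Finset.sdiff_sdiff_eq_self (hDS X' hX')
    simp only at h
    rw [← e₁, ← e₂, h]
  have hsub : M \\ M ⊆ {G ∈ S.powerset | f G = bot ∧ f (S \ G) = top ∧
      ∃ X ∈ D, ∃ Y ∈ D, G = (S \ X) \ (S \ Y) ∨ G = (S \ X) ∩ (S \ Y)} := by
    intro G hG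
    obtain ⟨C, hC, C', hC', rfl⟩ := mem_diffs.mp hG
    obtain ⟨X, hX, rfl⟩ := mem_image.mp hC
    obtain ⟨Y, hY, rfl⟩ := mem_image.mp hC'
    have hXS := hDS X hX
    have hYS := hDS Y hY
    -- (S \ X) \ (S \ Y) = Y \ X inside S
    have hGY : (S \ X) \ (S \ Y) ⊆ Y := by
      intro x hx
      rw [mem_sdiff, mem_sdiff, mem_sdiff] at hx
      by_contra h
      exact hx.2 ⟨hx.1.1, h⟩
    have hsupX : X ⊆ S \ ((S \ X) \ (S \ Y)) := by
      intro x hx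
      exact mem_sdiff.mpr ⟨hXS hx, fun h => (mem_sdiff.mp (mem_sdiff.mp h).1).2 hx⟩
    have hsupY : S \ Y ⊆ S \ ((S \ X) \ (S \ Y)) := sdiff_subset_sdiff le_rfl hGY
    rw [mem_filter, mem_powerset]
    refine ⟨sdiff_subset.trans sdiff_subset, ?_, ?_, X, hX, Y, hY, Or.inl rfl⟩
    · refine eq_bot_of_le_petal (hsep X hX Y hY) ?_ ?_
      · rw [← hDj X hX]; exact hf sdiff_subset
      · rw [← hDi Y hY]; exact hf hGY
    · refine eq_top_of_petal_le (hsep Y hY X hX).symm ?_ ?_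
      · rw [← hDi X hX]; exact hf hsupX
      · rw [← hDj Y hY]; exact hf hsupY
  calc #D = #M := hcM.symm
    _ ≤ #(M \\ M) := Finset.card_le_card_diffs M
    _ ≤ _ := card_le_card hsub

/-- **W2 for a 2-path (or an opposite pair).**  `D₁` bads of type `(a,b)`, `D₂` bads of type `(b,d)` inside `S`, `a ≠ b`,
`b ≠ d` (`d = a` allowed), members pairwise intersecting across the classes (`¬ S \ X ⊆ Y`).  Then the co-good words of length
two of `D₁ ∪ D₂` — here: the differences inside each class and the cross meets `(S \ X) ∩ (S \ Y)` — are at least `#D₁ + #D₂`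
many.  [`MS2′` with `𝒞 = {S \ X : X ∈ D₁}`, `ℬ = D₂`.] -/
theorem card_add_card_le_card_wordsTwo_of_twoPath (S : Finset α) {f : Finset α → Lab k}
    (hf : ∀ ⦃X Y : Finset α⦄, X ⊆ Y → f X ≤ f Y) (D₁ D₂ : Finset (Finset α)) {a b d : Fin k}
    (hab : a ≠ b) (hbd : b ≠ d)
    (h₁S : ∀ X ∈ D₁, X ⊆ S) (h₁a : ∀ X ∈ D₁, f X = petal a) (h₁b : ∀ X ∈ D₁, f (S \ X) = petal b)
    (h₂S : ∀ Y ∈ D₂, Y ⊆ S) (h₂b : ∀ Y ∈ D₂, f Y = petal b) (h₂d : ∀ Y ∈ D₂, f (S \ Y) = petal d)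
    (hCoI : ∀ X ∈ D₁, ∀ Y ∈ D₂, ¬ S \ X ⊆ Y) :
    #D₁ + #D₂ ≤ #{G ∈ S.powerset | f G = bot ∧ f (S \ G) = top ∧
      ∃ X ∈ D₁ ∪ D₂, ∃ Y ∈ D₁ ∪ D₂, G = (S \ X) \ (S \ Y) ∨ G = (S \ X) ∩ (S \ Y)} := by
  classical
  set 𝒞 : Finset (Finset α) := D₁.image fun X => S \ X with h𝒞
  have hc1 : #𝒞 = #D₁ := by
    rw [h𝒞]
    refine card_image_of_injOn ?_
    intro X hX X' hX' h
    have e₁ := Finset.sdiff_sdiff_eq_self (h₁S X hX)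
    have e₂ := Finset.sdiff_sdiff_eq_self (h₁S X' hX')
    simp only at h
    rw [← e₁, ← e₂, h]
  have hMS := card_add_card_le_card_diffs_union 𝒞 D₂ (by
    intro C hC Y hY
    obtain ⟨X, hX, rfl⟩ := mem_image.mp hC
    exact hCoI X hX Y hY)
  have hsub : (𝒞 \\ 𝒞) ∪ (𝒞 \\ D₂) ∪ (D₂ \\ D₂) ⊆ {G ∈ S.powerset | f G = bot ∧ f (S \ G) = top ∧
      ∃ X ∈ D₁ ∪ D₂, ∃ Y ∈ D₁ ∪ D₂, G = (S \ X) \ (S \ Y) ∨ G = (S \ X) ∩ (S \ Y)} := by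
    intro G hG
    rw [mem_union, mem_union] at hG
    rw [mem_filter, mem_powerset]
    rcases hG with (hG | hG) | hG
    · -- G = (S \ X) \ (S \ X'), X, X' ∈ D₁
      obtain ⟨C, hC, C', hC', rfl⟩ := mem_diffs.mp hG
      obtain ⟨X, hX, rfl⟩ := mem_image.mp hC
      obtain ⟨X', hX', rfl⟩ := mem_image.mp hC'
      have hXS := h₁S X hX
      have hG' : (S \ X) \ (S \ X') ⊆ X' := by
        intro x hx
        rw [mem_sdiff, mem_sdiff, mem_sdiff] at hx
        by_contra h
        exact hx.2 ⟨hx.1.1, h⟩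
      have hsupX : X ⊆ S \ ((S \ X) \ (S \ X')) := by
        intro x hx
        exact mem_sdiff.mpr ⟨hXS hx, fun h => (mem_sdiff.mp (mem_sdiff.mp h).1).2 hx⟩
      have hsupX' : S \ X' ⊆ S \ ((S \ X) \ (S \ X')) := sdiff_subset_sdiff le_rfl hG'
      refine ⟨sdiff_subset.trans sdiff_subset, ?_, ?_, X, mem_union_left _ hX, X', mem_union_left _ hX', Or.inl rfl⟩
      · refine eq_bot_of_le_petal hab ?_ ?_
        · rw [← h₁a X' hX']; exact hf hG'
        · rw [← h₁b X hX]; exact hf sdiff_subset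
      · refine eq_top_of_petal_le hab ?_ ?_
        · rw [← h₁a X hX]; exact hf hsupX
        · rw [← h₁b X' hX']; exact hf hsupX'
    · -- G = (S \ X) \ Y = (S \ X) ∩ (S \ Y), X ∈ D₁, Y ∈ D₂
      obtain ⟨C, hC, Y, hY, rfl⟩ := mem_diffs.mp hG
      obtain ⟨X, hX, rfl⟩ := mem_image.mp hC
      have hXS := h₁S X hX
      have hYS := h₂S Y hY
      have heq : (S \ X) \ Y = (S \ X) ∩ (S \ Y) := by
        ext x
        simp only [mem_sdiff, mem_inter]
        tauto
      have hsupX : X ⊆ S \ ((S \ X) \ Y) := by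
        intro x hx
        exact mem_sdiff.mpr ⟨hXS hx, fun h => (mem_sdiff.mp (mem_sdiff.mp h).1).2 hx⟩
      have hsupY : Y ⊆ S \ ((S \ X) \ Y) := by
        intro y hy
        exact mem_sdiff.mpr ⟨hYS hy, fun h => (mem_sdiff.mp h).2 hy⟩
      refine ⟨sdiff_subset.trans sdiff_subset, ?_, ?_, X, mem_union_left _ hX, Y, mem_union_right _ hY, Or.inr heq⟩
      · refine eq_bot_of_le_petal hbd ?_ ?_
        · rw [← h₁b X hX]; exact hf sdiff_subset
        · rw [← h₂d Y hY]; exact hf (sdiff_subset_sdiff sdiff_subset le_rfl)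
      · refine eq_top_of_petal_le hab ?_ ?_
        · rw [← h₁a X hX]; exact hf hsupX
        · rw [← h₂b Y hY]; exact hf hsupY
    · -- G = Y \ Y' = (S \ Y') \ (S \ Y), Y, Y' ∈ D₂
      obtain ⟨Y, hY, Y', hY', rfl⟩ := mem_diffs.mp hG
      have hYS := h₂S Y hY
      have hY'S := h₂S Y' hY'
      have heq : Y \ Y' = (S \ Y') \ (S \ Y) := by
        ext x
        simp only [mem_sdiff]
        constructor
        · rintro ⟨hxY, hxY'⟩
          exact ⟨⟨hYS hxY, hxY'⟩, fun h => h.2 hxY⟩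
        · rintro ⟨⟨hxS, hxY'⟩, h⟩
          refine ⟨?_, hxY'⟩
          by_contra hxY
          exact h ⟨hxS, hxY⟩
      have hsupY' : Y' ⊆ S \ (Y \ Y') := by
        intro y hy
        exact mem_sdiff.mpr ⟨hY'S hy, fun h => (mem_sdiff.mp h).2 hy⟩
      have hsupY : S \ Y ⊆ S \ (Y \ Y') := sdiff_subset_sdiff le_rfl sdiff_subset
      refine ⟨sdiff_subset.trans hYS, ?_, ?_, Y', mem_union_right _ hY', Y, mem_union_right _ hY, Or.inl heq⟩
      · refine eq_bot_of_le_petal hbd ?_ ?_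
        · rw [← h₂b Y hY]; exact hf sdiff_subset
        · rw [← h₂d Y' hY']; exact hf (sdiff_subset_sdiff hYS le_rfl)
      · refine eq_top_of_petal_le hbd ?_ ?_
        · rw [← h₂b Y' hY']; exact hf hsupY'
        · rw [← h₂d Y hY]; exact hf hsupY
  calc #D₁ + #D₂ = #𝒞 + #D₂ := by rw [hc1]
    _ ≤ #((𝒞 \\ 𝒞) ∪ (𝒞 \\ D₂) ∪ (D₂ \\ D₂)) := hMS
    _ ≤ _ := card_le_card hsub

/-- **The W2 socket.**  If every sub-family `D'` of a family `D` of bads inside `S` has at most as many members as there are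
co-good words of length two of `D'` (Conjecture W2 for the sub-families of `D`), then `D` has distinct good representatives
(Hall): every such word `G` is the complement of the good `S \ G`, which lies above a bad of `D'`. -/
theorem exists_injective_good_above_of_wordsTwo (S : Finset α) {f : Finset α → Lab k}
    (D : Finset (Finset α)) (hDS : ∀ X ∈ D, X ⊆ S)
    (hW2 : ∀ D' ⊆ D, #D' ≤ #{G ∈ S.powerset | f G = bot ∧ f (S \ G) = top ∧
      ∃ X ∈ D', ∃ Y ∈ D', G = (S \ X) \ (S \ Y) ∨ G = (S \ X) ∩ (S \ Y)}) :
    ∃ φ : D → Finset α, Function.Injective φ ∧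
      ∀ X : D, (X : Finset α) ⊆ φ X ∧ φ X ⊆ S ∧ f (φ X) = top ∧ f (S \ φ X) = bot := by
  classical
  let t : D → Finset (Finset α) := fun X =>
    {U ∈ S.powerset | f U = top ∧ f (S \ U) = bot ∧ (X : Finset α) ⊆ U}
  have hHall : ∀ s : Finset D, #s ≤ #(s.biUnion t) := by
    intro s
    set D' : Finset (Finset α) := s.map (Function.Embedding.subtype _) with hD'
    have hD'sub : D' ⊆ D := by
      intro X hX
      obtain ⟨x, -, rfl⟩ := mem_map.mp hX
      exact x.2
    have hcard : #s = #D' := (card_map _).symm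
    set Wd : Finset (Finset α) := {G ∈ S.powerset | f G = bot ∧ f (S \ G) = top ∧
      ∃ X ∈ D', ∃ Y ∈ D', G = (S \ X) \ (S \ Y) ∨ G = (S \ X) ∩ (S \ Y)} with hWd
    have hWS : ∀ G ∈ Wd, G ⊆ S := by
      intro G hG
      rw [hWd, mem_filter, mem_powerset] at hG
      exact hG.1
    have hinj : Set.InjOn (fun G => S \ G) (Wd : Set (Finset α)) := by
      intro G₁ hG₁ G₂ hG₂ h
      have e₁ := Finset.sdiff_sdiff_eq_self (hWS G₁ hG₁)
      have e₂ := Finset.sdiff_sdiff_eq_self (hWS G₂ hG₂)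
      simp only at h
      rw [← e₁, ← e₂, h]
    have himg : Wd.image (fun G => S \ G) ⊆ s.biUnion t := by
      intro U hU
      obtain ⟨G, hG, rfl⟩ := mem_image.mp hU
      have hGS := hWS G hG
      rw [hWd, mem_filter, mem_powerset] at hG
      obtain ⟨-, hGbot, hGtop, X, hX, Y, -, hGXY⟩ := hG
      obtain ⟨x, hx, rfl⟩ := mem_map.mp hX
      rw [mem_biUnion]
      refine ⟨x, hx, ?_⟩
      simp only [t, mem_filter, mem_powerset]
      refine ⟨sdiff_subset, ?_, ?_, ?_⟩
      · exact hGtop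
      · rw [Finset.sdiff_sdiff_eq_self hGS]; exact hGbot
      · -- the bad `x` is disjoint from `G ⊆ S \ x`, hence inside `S \ G`
        intro a ha
        have haS : a ∈ S := hDS _ x.2 ha
        refine mem_sdiff.mpr ⟨haS, fun haG => ?_⟩
        have hGx : G ⊆ S \ (x : Finset α) := by
          rcases hGXY with h | h
          · rw [h]; exact sdiff_subset
          · rw [h]; exact inter_subset_left
        exact (mem_sdiff.mp (hGx haG)).2 ha
    calc #s = #D' := hcard
      _ ≤ #Wd := hW2 D' hD'sub
      _ = #(Wd.image fun G => S \ G) := (card_image_of_injOn hinj).symm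
      _ ≤ #(s.biUnion t) := card_le_card himg
  obtain ⟨φ, hφinj, hφ⟩ := (all_card_le_biUnion_card_iff_exists_injective t).mp hHall
  refine ⟨φ, hφinj, fun X => ?_⟩
  have hX := hφ X
  simp only [t, mem_filter, mem_powerset] at hX
  exact ⟨hX.2.2.2, hX.1, hX.2.1, hX.2.2.1⟩

end OrientedAntipodalHall

end Summit.CriticalPhenomena.PercolationContinuityZ3.Theorems
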